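import Literature.Topology.FourManifolds.ClosedOrientableSurfaces
import Literature.Topology.FourManifolds.DiscTheoremDiffeotopy
import HarnessLib

/-!
# The genus-two surface `Σ₂ = T² # T²` with its two torus summands and a small neck

Topic `Literature/Topology/FourManifolds` (fact seat of the Seiberg–Witten leaf
`Literature.Barriers.SmoothPoincare4.akhmedovPark2010_lemma8_invariants`; block 1 of
Akhmedov–Park's `X₁(m)`, A. Akhmedov, B. D. Park, Invent. Math. 181 (2010), §2 and §9: the
curves `a₁, b₁` (first torus) and `a₂` with its parallel copies `a₂′, a₂″` (second torus) of
`Σ₂ = T² # T²` along which the Luttinger surgery tori of eq. (9.1) are built; they must avoid the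
neck of the connected sum).  The tree's genus-two surface (`exists_genusTwoSurface`,
`ClosedOrientableSurfaces.lean`) is a connected sum `T # T` of two copies of the torus
`T ≅ S¹ × S¹` along discs chosen by the existence theorem, i.e. ANYWHERE; to place explicit curves
in the summands one needs the discs to be SMALL.  This file redoes the construction with
controlled discs:

* `exists_connectedSumData_oriented_source_subset` — **oriented connected-sum data with
  prescribed neighbourhoods**: for oriented smooth `n`-manifolds `M`, `N` (`n ≠ 0`), points
  `x`, `y` and neighbourhoods `U ∋ x`, `V ∋ y` there are connected-sum data (charts onto `ℝⁿ`,
  `ConnectedSumData`) whose chart sources lie in `U`, `V`, with the first disc orientation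
  preserving and the second orientation reversing (controlled charts
  `exists_mem_maximalAtlas_target_eq_univ_source_subset_apply_eq_zero` + the orientation
  bookkeeping of `exists_connectedSumData_oriented`, Kervaire–Milnor 1963 §2);
* `exists_genusTwoSurface_summands` — **`Σ₂ = T # T` glued inside the quarter region**: for the
  torus `T = Rechart f₂ (S¹ × S¹)` recharted on `ℝ²` along a linear `f₂` (exported with its two
  smoothness properties, the hypotheses of `TorusCurveTubes.lean` / `SurfaceTimesTorusTori.lean`)
  there is a closed connected oriented smooth surface `F`, a connected sum `T # T`
  (`IsConnectedSum`, so `H₁(F) ≅ ℤ⁴` by `ClosedOrientableSurfaces.lean`), with the two open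
  smooth embeddings `jA : A → F`, `jB : B → F` of the punctured tori (`A, B ⊆ T` open) covering
  `F`, such that the complement of the quarter region
  `U = {w | Re (out w).1 > 0 ∧ Re (out w).2 > 0}` lies in both `A` and `B` and the two pieces
  are glued only inside `U`: `jA a = jB b → a ∈ U ∧ b ∈ U`.  Hence curves of the first torus
  outside `U` (e.g. `S¹ × {-1}`, `{-1} × S¹`) and curves of the second torus outside `U` have
  disjoint images in `F` — the curves `a₁, b₁` and `a₂′, a₂″` of Akhmedov–Park.

Everything is proved; no definitions, no named facts.

## References

* M. Kervaire, J. Milnor, *Groups of homotopy spheres I*, Ann. of Math. 77 (1963), §2.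
  [KervaireMilnor1963]
* A. Hatcher, *Algebraic Topology* (2002), Ch. 0 p. 5 (`M_g = T² # ⋯ # T²`). [HatcherAT2002]
* A. Akhmedov, B. D. Park, Invent. Math. 181 (2010), §2, §9. [AkhmedovPark2010]
-/

noncomputable section

open scoped Manifold ContDiff Topology
open Set Function Module
open Literature.Geometry.Manifold (Rechart)
open Literature.AlgebraicTopology.SingularHomology

namespace Literature.Topology.FourManifolds

universe u

/-! ### Oriented connected-sum data with small discs -/

section Data

variable {n : ℕ} {M N : Type u} [TopologicalSpace M] [ChartedSpace (EuclideanSpace ℝ (Fin n)) M]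
  [IsManifold (𝓡 n) ∞ M] [TopologicalSpace N] [ChartedSpace (EuclideanSpace ℝ (Fin n)) N]
  [IsManifold (𝓡 n) ∞ N]

/-- **Oriented connected-sum data with prescribed neighbourhoods.**  For oriented smooth
`n`-manifolds `M`, `N`, `n ≠ 0`, points `x ∈ M`, `y ∈ N` and neighbourhoods `U ∋ x`, `V ∋ y` there
are connected-sum data `D` (charts `e₁`, `e₂` onto `ℝⁿ` of the maximal atlases) with
`e₁.source ⊆ U`, `e₂.source ⊆ V`, whose first disc `i₁ = e₁⁻¹` preserves and whose second disc
`i₂` reverses orientation for one constant orientation `o₀` of `ℝⁿ` (Kervaire–Milnor 1963 §2: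
"so that `i₁` preserves orientation and `i₂` reverses orientation", the discs taken inside any
prescribed open sets). [cite: KervaireMilnor1963, §2] -/
theorem exists_connectedSumData_oriented_source_subset (hn : n ≠ 0)
    (oM : SmoothOrientation (𝓡 n) M) (oN : SmoothOrientation (𝓡 n) N) {x : M} {y : N}
    {U : Set M} {V : Set N} (hU : U ∈ 𝓝 x) (hV : V ∈ 𝓝 y) :
    ∃ (D : ConnectedSumData n M N) (o₀ : Orientation ℝ (EuclideanSpace ℝ (Fin n))
        (Fin (finrank ℝ (EuclideanSpace ℝ (Fin n))))),
      D.e₁.source ⊆ U ∧ D.e₂.source ⊆ V ∧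
      IsOrientationPreserving (SmoothOrientation.modelSpace o₀) oM D.i₁ ∧
        IsOrientationReversing (SmoothOrientation.modelSpace o₀) oN D.i₂ := by
  obtain ⟨e₁, he₁, -, hs₁, ht₁, -⟩ :=
    exists_mem_maximalAtlas_target_eq_univ_source_subset_apply_eq_zero (n := n) x hU
  obtain ⟨e₂, he₂, -, hs₂, ht₂, -⟩ :=
    exists_mem_maximalAtlas_target_eq_univ_source_subset_apply_eq_zero (n := n) y hV
  let D : ConnectedSumData n M N := ⟨e₁, e₂, he₁, he₂, ht₁, ht₂⟩
  obtain ⟨o₀, h₁⟩ := exists_isOrientationPreserving_disc D.isSmoothEmbedding_i₁ D.isOpen_range_i₁ oM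
  rcases isOrientationPreserving_or_isOrientationReversing_disc D.isSmoothEmbedding_i₂
    D.isOpen_range_i₂ o₀ oN with h₂ | h₂
  · obtain ⟨R, hR⟩ := exists_linearIsometryEquiv_det_eq_neg_one hn
    have hRs : LinearMap.det (R.symm.toLinearEquiv :
        (EuclideanSpace ℝ (Fin n)) →ₗ[ℝ] (EuclideanSpace ℝ (Fin n))) < 0 := by
      have h : LinearMap.det (R.symm.toLinearEquiv :
          (EuclideanSpace ℝ (Fin n)) →ₗ[ℝ] (EuclideanSpace ℝ (Fin n))) =
          (LinearMap.det (R.toLinearEquiv :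
            (EuclideanSpace ℝ (Fin n)) →ₗ[ℝ] (EuclideanSpace ℝ (Fin n))))⁻¹ :=
        LinearEquiv.det_coe_symm R.toLinearEquiv
      rw [h, hR]
      norm_num
    refine ⟨D.reflectRight R, o₀, hs₁, ?_, h₁, ?_⟩
    · show (D.e₂ ≫ₕ R.toHomeomorph.toOpenPartialHomeomorph).source ⊆ V
      rw [OpenPartialHomeomorph.trans_source, Homeomorph.toOpenPartialHomeomorph_source,
        preimage_univ, inter_univ]
      exact hs₂
    · rw [D.reflectRight_i₂]
      exact isOrientationReversing_disc_comp D.isSmoothEmbedding_i₂ D.isOpen_range_i₂ h₂ R.symm hRs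
  · exact ⟨D, o₀, hs₁, hs₂, h₁, h₂⟩

end Data

/-! ### `Σ₂ = T # T` glued inside the quarter region of the torus -/

/-- **The genus-two surface with its two torus summands and a small neck.**  There are a linear
recharting `f₂` of `S¹ × S¹` on `ℝ²` (smooth in both directions), and for the torus
`T = Rechart f₂ (S¹ × S¹)`: a closed connected smoothly oriented surface `F` which is a connected
sum `T # T` (`IsConnectedSum`), open sets `A, B ⊆ T` (the punctured tori) with open smooth
embeddings `jA : A → F`, `jB : B → F` covering `F`, both containing the complement of the quarter
region `U = {Re (out w).1 > 0 ∧ Re (out w).2 > 0}`, and glued only inside `U`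
(`jA a = jB b → a, b ∈ U`).  (Hatcher 2002, Ch. 0 p. 5: `M₂ = T² # T²`; Kervaire–Milnor 1963 §2;
the summands carry the curves `a₁, b₁` and `a₂′, a₂″` of Akhmedov–Park 2010 §9 outside `U`.)
[cite: HatcherAT2002, Ch. 0 p. 5] [cite: KervaireMilnor1963, §2] [cite: AkhmedovPark2010, §2 and §9] -/
theorem exists_genusTwoSurface_summands :
    ∃ (f₂ : ModelProd (EuclideanSpace ℝ (Fin 1)) (EuclideanSpace ℝ (Fin 1)) ≃ₜ
        EuclideanSpace ℝ (Fin 2)),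
      ContMDiff ((𝓡 1).prod (𝓡 1)) 𝓘(ℝ, EuclideanSpace ℝ (Fin 2)) ∞ f₂ ∧
      ContMDiff 𝓘(ℝ, EuclideanSpace ℝ (Fin 2)) ((𝓡 1).prod (𝓡 1)) ∞ f₂.symm ∧
      ∃ (F : Type) (_ : TopologicalSpace F) (_ : T2Space F) (_ : SecondCountableTopology F)
        (_ : ChartedSpace (EuclideanSpace ℝ (Fin 2)) F) (_ : IsManifold (𝓡 2) ∞ F)
        (_ : CompactSpace F) (_ : ConnectedSpace F) (_ : SmoothOrientation (𝓡 2) F)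
        (A B : TopologicalSpace.Opens (Rechart f₂ (Circle × Circle))) (jA : A → F) (jB : B → F),
        IsConnectedSum (𝓡 2) (𝓡 2) (𝓡 2) (Rechart f₂ (Circle × Circle))
          (Rechart f₂ (Circle × Circle)) F ∧
        Manifold.IsSmoothEmbedding (𝓡 2) (𝓡 2) ∞ jA ∧ IsOpen (range jA) ∧
        Manifold.IsSmoothEmbedding (𝓡 2) (𝓡 2) ∞ jB ∧ IsOpen (range jB) ∧
        range jA ∪ range jB = univ ∧
        {w | ¬ (0 < (((Rechart.out f₂ (Circle × Circle) w).1 : Circle) : ℂ).re ∧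
            0 < (((Rechart.out f₂ (Circle × Circle) w).2 : Circle) : ℂ).re)} ⊆ (A : Set _) ∧
        {w | ¬ (0 < (((Rechart.out f₂ (Circle × Circle) w).1 : Circle) : ℂ).re ∧
            0 < (((Rechart.out f₂ (Circle × Circle) w).2 : Circle) : ℂ).re)} ⊆ (B : Set _) ∧
        (∀ a b, jA a = jB b →
          (0 < (((Rechart.out f₂ (Circle × Circle) (a : Rechart f₂ (Circle × Circle))).1 :
              Circle) : ℂ).re ∧
            0 < (((Rechart.out f₂ (Circle × Circle) (a : Rechart f₂ (Circle × Circle))).2 :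
              Circle) : ℂ).re) ∧
          (0 < (((Rechart.out f₂ (Circle × Circle) (b : Rechart f₂ (Circle × Circle))).1 :
              Circle) : ℂ).re ∧
            0 < (((Rechart.out f₂ (Circle × Circle) (b : Rechart f₂ (Circle × Circle))).2 :
              Circle) : ℂ).re)) := by
  -- the torus `T = S¹ × S¹` recharted on `ℝ²` (as in `exists_twoTorus_model`)
  let L : (EuclideanSpace ℝ (Fin 1) × EuclideanSpace ℝ (Fin 1)) ≃L[ℝ] EuclideanSpace ℝ (Fin 2) :=
    ContinuousLinearEquiv.ofFinrankEq (by simp)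
  let f₂ : ModelProd (EuclideanSpace ℝ (Fin 1)) (EuclideanSpace ℝ (Fin 1)) ≃ₜ
      EuclideanSpace ℝ (Fin 2) := L.toHomeomorph
  have hIf : ∀ x, f₂ x = L (((𝓡 1).prod (𝓡 1)) x) := fun x => rfl
  have hf₂ := Rechart.contMDiff_of_apply_eq_linear (I := (𝓡 1).prod (𝓡 1)) (n := ∞) f₂ L hIf
  have hf₂' := Rechart.contMDiff_symm_of_apply_eq_linear (I := (𝓡 1).prod (𝓡 1)) (n := ∞) f₂ L hIf
  haveI hT : IsManifold (𝓡 2) ∞ (Rechart f₂ (Circle × Circle)) := Rechart.isManifold f₂ _ hf₂ hf₂'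
  haveI : SecondCountableTopology (Rechart f₂ (Circle × Circle)) :=
    inferInstanceAs (SecondCountableTopology (Circle × Circle))
  haveI : ConnectedSpace (Rechart f₂ (Circle × Circle)) :=
    inferInstanceAs (ConnectedSpace (Circle × Circle))
  haveI : Nonempty (Rechart f₂ (Circle × Circle)) := inferInstance
  -- a smooth orientation of the torus
  have hO' := @isOrientableOver_int_of_isTopologicalGroup 2 (Circle × Circle) _ _ _ _
    (Rechart.instChartedSpace f₂ (Circle × Circle))
  have hO : IsOrientableOver ℤ (Rechart f₂ (Circle × Circle)) 2 := hO'
  obtain ⟨μT⟩ := hO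
  obtain ⟨g⟩ : Nonempty (HomologicalOrientation ℤ (EuclideanSpace ℝ (Fin 2)) 2) :=
    isOrientableOver_of_simplyConnectedSpace ℤ (EuclideanSpace ℝ (Fin 2)) (n := 2)
  obtain ⟨oT⟩ := nonempty_smoothOrientation_of_homologicalOrientation (Rechart f₂ (Circle × Circle))
    g μT
  -- the quarter region `U` about `into (1, 1)`
  set U : Set (Rechart f₂ (Circle × Circle)) :=
    {w | 0 < (((Rechart.out f₂ (Circle × Circle) w).1 : Circle) : ℂ).re ∧
      0 < (((Rechart.out f₂ (Circle × Circle) w).2 : Circle) : ℂ).re} with hU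
  have hcoe : Continuous fun z : Circle => ((z : ℂ)).re :=
    Complex.continuous_re.comp continuous_subtype_val
  have hUo : IsOpen U := by
    have hout : Continuous (Rechart.out f₂ (Circle × Circle)) := Rechart.continuous_out f₂ _
    exact (isOpen_lt continuous_const (hcoe.comp (continuous_fst.comp hout))).inter
      (isOpen_lt continuous_const (hcoe.comp (continuous_snd.comp hout)))
  have hx₀ : Rechart.into f₂ (Circle × Circle) (1, 1) ∈ U := by
    show 0 < (((Rechart.out f₂ (Circle × Circle) (Rechart.into f₂ (Circle × Circle) (1, 1))).1 :
        Circle) : ℂ).re ∧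
      0 < (((Rechart.out f₂ (Circle × Circle) (Rechart.into f₂ (Circle × Circle) (1, 1))).2 :
        Circle) : ℂ).re
    rw [Rechart.out_into]
    simp
  -- connected-sum data with both discs inside `U`
  obtain ⟨D, o₀, hs₁, hs₂, h₁, h₂⟩ := exists_connectedSumData_oriented_source_subset two_ne_zero oT oT
    (hUo.mem_nhds hx₀) (hUo.mem_nhds hx₀)
  -- the glued surface
  haveI := D.t2Space_glued two_ne_zero
  haveI := D.compactSpace_glued two_ne_zero
  haveI := D.secondCountableTopology_glued two_ne_zero
  have hOCS := D.isOrientedConnectedSum_glued two_ne_zero oT oT o₀ h₁ h₂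
  have hCS := hOCS.isConnectedSum
  haveI : ConnectedSpace (D.Glued two_ne_zero) :=
    IsConnectedSum.connectedSpace_holds (by rw [finrank_euclideanSpace_fin]; norm_num) hCS
  -- the discs lie in `U`
  have hi₁U : range D.i₁ ⊆ U := by rw [D.range_i₁]; exact hs₁
  have hi₂U : range D.i₂ ⊆ U := by rw [D.range_i₂]; exact hs₂
  have hAU : Uᶜ ⊆ (D.A : Set (Rechart f₂ (Circle × Circle))) := by
    intro w hw
    show w ≠ D.i₁ 0
    rintro rfl
    exact hw (hi₁U ⟨0, rfl⟩)
  have hBU : Uᶜ ⊆ (D.B : Set (Rechart f₂ (Circle × Circle))) := by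
    intro w hw
    show w ≠ D.i₂ 0
    rintro rfl
    exact hw (hi₂U ⟨0, rfl⟩)
  refine ⟨f₂, hf₂, hf₂', D.Glued two_ne_zero, inferInstance, inferInstance, inferInstance,
    inferInstance, inferInstance, inferInstance, inferInstance,
    D.orientation two_ne_zero oT oT o₀ h₁ h₂, D.A, D.B, (D.glueData two_ne_zero).inl,
    (D.glueData two_ne_zero).inr, hCS, (D.glueData two_ne_zero).isSmoothEmbedding_inl,
    (D.glueData two_ne_zero).isOpen_range_inl, (D.glueData two_ne_zero).isSmoothEmbedding_inr,
    (D.glueData two_ne_zero).isOpen_range_inr, (D.glueData two_ne_zero).range_inl_union_range_inr,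
    fun w hw => hAU hw, fun w hw => hBU hw, ?_⟩
  -- the gluing happens inside `U`
  intro a b hab
  have hrel : connectedSumRel D.i₁ D.i₂ a b :=
    (D.connectedSumRel_iff_φ two_ne_zero a b).2 ((D.glueData two_ne_zero).inl_eq_inr_iff.1 hab)
  obtain ⟨u, t, -, -, ha, hb⟩ := hrel
  exact ⟨hi₁U ⟨_, ha.symm⟩, hi₂U ⟨_, hb.symm⟩⟩

end Literature.Topology.FourManifolds
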